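import Summits.Ventures.LatticeQCDFlow.Scoring.SU2TorusWilsonLoopCharacterIntegral
import HarnessLib

/-!
# SU(2) on the 2-torus: merging an ANNULUS of plaquettes onto its two boundary Polyakov lines, inside the full product Haar integral

HONEST FRAMING: exact (Metropolis-corrected) sampling algorithms for lattice gauge theory;
figures of merit are autocorrelation/cost numbers at stated couplings and volumes; no
continuum-physics claim.

Venture `LatticeQCDFlow` (cell pub-lqcd), sub-topic `Scoring`; FANOUT row 5 (`s0-sun-a`), GEN-11.
NEW WORK of the cell (placement rule); the tools behind the exact SU(2) torus Polyakov-loop expectation and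
two-point function (the lead's NOT-TYPED item 'Polyakov correlators', oracle X02's `polyakov_loop` /
`polyakov_2pt`).  The Polyakov line winding in direction `0` through `(i,j)` is the row holonomy
`P_j(V) = h(i,j) h(i+1,j) ⋯ h(i+L−1,j)`; `χ_n = U_n(a₀)`.

* `integral_pi_haar_mul_of_update_eq` — `w_c·T(w)` is Haar distributed, WITH A SPECTATOR: for a
  right-invariant probability `ν`, `∫ φ(w_c·T(w))·G(w) dν^{⊗ι} = (∫ φ dν)·∫ G dν^{⊗ι}` when `T, G` ignore `c`
  (two Polyakov lines of different rows are independent Haar variables);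
* `integral_su2a0_mul_su2Character_mul_su2Character` — `∫ a₀ χ_μ χ_λ dHaar = ½[λ = μ+1] + ½[μ ≠ 0][λ = μ−1]`
  (Clebsch–Gordan and orthonormality);
* `plaquetteHolonomy_update_vert/horiz_of_row_ne`, `rowProd_update_of_ne` — links of other rows;
* **`integral_mul_prod_annulus_su2Character`** — THE ANNULUS: for `1 ≤ T ≤ L`, merging the `LT`
  plaquettes of the rows `j, …, j+T−1` (`SU2TorusRectangleMerging` with `R = L`) and closing the handle
  along the vertical line through column `i` (`SU2CharacterRowIntegral.integral_pi_su2_handle`) leaves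
  `[m ≡ m(i,j) on the rows]·((m(i,j)+1)^{LT})⁻¹·χ(P_j)·χ(P_{j+T})` against any continuous spectator not
  depending on the vertical links of these rows nor on `h(i,j+b)`, `0 < b < T` — the cylinder amplitude
  `Σ_r λ_r^{LT} χ_r(P_j) χ_r(P_{j+T})` of 2-d Yang–Mills, term by term.

Elementary given the parents; nothing is cited; no `def`.
-/

noncomputable section

open Real MeasureTheory Set Function Finset Polynomial.Chebyshev
open Literature.MathematicalPhysics.QuantumFieldTheory Literature.MathematicalPhysics.QuantumLattice
open Summit.Ventures.LatticeQCDFlow.Exactness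
open Summit.Ventures.LatticeQCDFlow.Theory2.Lattice

namespace Summit.Ventures.LatticeQCDFlow.Scoring

/-! ## §1. A Haar coordinate times anything independent of it, against a spectator -/

section Haar

variable {ι : Type*} [Fintype ι] [DecidableEq ι] {G : Type*} [Group G] [MeasurableSpace G]
  [MeasurableMul G]

/-- **`w_c · T(w)` is `ν`-distributed, with a spectator.**  For a right-invariant probability measure
`ν`, maps `T : (ι → G) → G` and `Gs : (ι → G) → ℝ` not depending on the coordinate `c`, and `φ` with the
product integrable: `∫ φ(w_c · T(w)) · Gs(w) dν^{⊗ι}(w) = (∫ φ dν) · ∫ Gs dν^{⊗ι}`. -/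
theorem integral_pi_haar_mul_of_update_eq (ν : Measure G) [IsProbabilityMeasure ν] [ν.IsMulRightInvariant]
    (c : ι) (T : (ι → G) → G) (hT : ∀ w g, T (update w c g) = T w) (Gs : (ι → G) → ℝ)
    (hGs : ∀ w g, Gs (update w c g) = Gs w) (φ : G → ℝ)
    (hint : Integrable (fun w : ι → G => φ (w c * T w) * Gs w) (Measure.pi fun _ : ι => ν)) :
    ∫ w, φ (w c * T w) * Gs w ∂(Measure.pi fun _ : ι => ν) =
      (∫ g, φ g ∂ν) * ∫ w, Gs w ∂(Measure.pi fun _ : ι => ν) := by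
  rw [integral_pi_eq_integral_update ν c hint]
  have h : ∀ w : ι → G, (∫ g, φ (update w c g c * T (update w c g)) * Gs (update w c g) ∂ν) =
      (∫ g, φ g ∂ν) * Gs w := by
    intro w
    simp_rw [update_self, hT, hGs]
    rw [integral_mul_const, integral_mul_right_eq_self (fun g => φ g) (T w)]
  simp_rw [h]
  rw [integral_const_mul]

end Haar

/-! ## §2. `∫ a₀ χ_μ χ_λ dHaar` -/

/-- **`∫ a₀·χ_μ·χ_λ dHaar = ½·[λ = μ+1] + ½·[μ ≠ 0]·[λ = μ−1]`** on `SU(2)`: Clebsch–Gordan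
`a₀χ_μ = ½(χ_{μ+1} + χ_{μ−1})` and orthonormality of the characters. -/
theorem integral_su2a0_mul_su2Character_mul_su2Character (μ ν : ℕ) :
    ∫ g, su2a0 g * (U ℝ μ).eval (su2a0 g) * (U ℝ ν).eval (su2a0 g)
        ∂(haarProbability (Matrix.specialUnitaryGroup (Fin 2) ℂ)) =
      (1 / 2) * (if ν = μ + 1 then 1 else 0) +
        (1 / 2) * (if μ = 0 then 0 else if ν = μ - 1 then 1 else 0) := by
  haveI := secondCountableTopology_su2
  have hi : ∀ p q : ℕ, Integrable (fun g : Matrix.specialUnitaryGroup (Fin 2) ℂ =>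
      (U ℝ p).eval (su2a0 g) * (U ℝ q).eval (su2a0 g))
      (haarProbability (Matrix.specialUnitaryGroup (Fin 2) ℂ)) := fun p q =>
    integrable_of_continuous_compactSpace
      ((continuous_su2Character_comp p continuous_id).mul (continuous_su2Character_comp q continuous_id))
  rcases Nat.eq_zero_or_pos μ with rfl | hμ
  · have hpt : ∀ g : Matrix.specialUnitaryGroup (Fin 2) ℂ,
        su2a0 g * (U ℝ (0 : ℕ)).eval (su2a0 g) * (U ℝ ν).eval (su2a0 g) =
        (1 / 2) * ((U ℝ (0 + 1 : ℕ)).eval (su2a0 g) * (U ℝ ν).eval (su2a0 g)) := by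
      intro g
      have h := mul_chebyshevU_eval ((0 : ℕ) : ℤ) (su2a0 g)
      push_cast at h
      simp only [U_neg_one, Polynomial.eval_zero, add_zero] at h
      push_cast
      rw [h]
      ring
    simp_rw [hpt]
    rw [integral_const_mul, integral_su2Character_mul_su2Character]
    by_cases hν : ν = 0 + 1
    · subst hν; simp
    · simp [hν, Ne.symm hν]
  · obtain ⟨k, rfl⟩ : ∃ k, μ = k + 1 := ⟨μ - 1, by omega⟩
    have hpt : ∀ g : Matrix.specialUnitaryGroup (Fin 2) ℂ,
        su2a0 g * (U ℝ (k + 1 : ℕ)).eval (su2a0 g) * (U ℝ ν).eval (su2a0 g) =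
        (1 / 2) * ((U ℝ (k + 1 + 1 : ℕ)).eval (su2a0 g) * (U ℝ ν).eval (su2a0 g)) +
          (1 / 2) * ((U ℝ k).eval (su2a0 g) * (U ℝ ν).eval (su2a0 g)) := by
      intro g
      have h := mul_chebyshevU_eval ((k + 1 : ℕ) : ℤ) (su2a0 g)
      push_cast at h
      rw [add_sub_cancel_right] at h
      push_cast
      rw [h]
      ring
    simp_rw [hpt]
    rw [integral_add ((hi _ _).const_mul _) ((hi _ _).const_mul _), integral_const_mul, integral_const_mul,
      integral_su2Character_mul_su2Character, integral_su2Character_mul_su2Character,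
      if_neg (Nat.succ_ne_zero k), Nat.add_sub_cancel]
    by_cases h1 : ν = k + 1 + 1
    · rw [if_pos h1, if_pos h1.symm]
      by_cases h2 : ν = k
      · omega
      · rw [if_neg h2, if_neg (Ne.symm h2)]
    · rw [if_neg h1, if_neg (Ne.symm h1)]
      by_cases h2 : ν = k
      · rw [if_pos h2, if_pos h2.symm]
      · rw [if_neg h2, if_neg (Ne.symm h2)]

/-! ## §3. Links of other rows; the annulus -/

variable {L : ℕ}

/-- A plaquette does not contain the vertical links of OTHER rows. -/
theorem plaquetteHolonomy_update_vert_of_row_ne {G : Type*} [Group G] {x y : Site 2 L} (h : x 1 ≠ y 1)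
    (V : GaugeConfig 2 L G) (g : G) :
    plaquetteHolonomy (update V (y, 1) g) x 0 1 = plaquetteHolonomy V x 0 1 := by
  refine TwoDim.plaquetteHolonomy_update_vert g (fun e => h (by rw [e])) fun e => h ?_
  rw [← e]
  simp [Site.shift]

/-- A plaquette does not contain the horizontal links of rows other than its own two. -/
theorem plaquetteHolonomy_update_horiz_of_row_ne {G : Type*} [Group G] {x y : Site 2 L} (h1 : x 1 ≠ y 1)
    (h2 : x 1 + 1 ≠ y 1) (V : GaugeConfig 2 L G) (g : G) :
    plaquetteHolonomy (update V (y, 0) g) x 0 1 = plaquetteHolonomy V x 0 1 := by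
  refine TwoDim.plaquetteHolonomy_update_horiz g (fun e => h1 (by rw [e])) fun e => h2 ?_
  rw [← e]
  simp [Site.shift]

/-- The row coordinate of `![x, y]` is `y`. -/
theorem vec2_apply_one (x y : ZMod L) : (![x, y] : Site 2 L) 1 = y := rfl

/-- A row holonomy is unchanged by updating a link of another row or a vertical link. -/
theorem rowProd_update_of_ne (i j : ZMod L) (V : GaugeConfig 2 L (Matrix.specialUnitaryGroup (Fin 2) ℂ))
    (e : Edge 2 L) (g : Matrix.specialUnitaryGroup (Fin 2) ℂ) (he : e.2 = 1 ∨ e.1 1 ≠ j) (n : ℕ) :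
    ((List.range n).map fun a : ℕ => update V e g (![i + a, j], 0)).prod =
      ((List.range n).map fun a : ℕ => V (![i + a, j], 0)).prod := by
  refine list_prod_map_update_of_ne V e g _ _ fun k _ h => ?_
  rcases he with he | he
  · rw [← h] at he
    exact Fin.zero_ne_one he
  · rw [← h] at he
    exact he rfl

variable [NeZero L]

/-- **THE ANNULUS.**  For a corner `(i,j)` and `1 ≤ T ≤ L`: merging the `LT` plaquettes of the rows
`j, …, j+T−1` (the rectangle lemma with `R = L`) and closing the handle along the vertical line through
column `i` gives, for every continuous spectator `F` not depending on the vertical links of these rows nor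
on the horizontal links `h(i,j+b)`, `0 < b < T`,
`∫ F · ∏_{b<T} ∏_{a<L} χ_{m(i+a,j+b)}(U_{(i+a,j+b)}) dHaar^{⊗E}
   = [m ≡ m(i,j) on the rows]·((m(i,j)+1)^{LT})⁻¹ · ∫ F · χ_{m(i,j)}(P_j) · χ_{m(i,j)}(P_{j+T}) dHaar^{⊗E}`,
`P_j = h(i,j) h(i+1,j) ⋯ h(i+L−1,j)` the Polyakov line (row holonomy) at height `j`. -/
theorem integral_mul_prod_annulus_su2Character (i j : ZMod L) (m : Site 2 L → ℕ) {T : ℕ} (hT : 1 ≤ T)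
    (hTL : T ≤ L) (F : GaugeConfig 2 L (Matrix.specialUnitaryGroup (Fin 2) ℂ) → ℝ) (hFc : Continuous F)
    (hFv : ∀ a b : ℕ, a < L → b < T → ∀ V g, F (update V (![i + a, j + b], 1) g) = F V)
    (hFh : ∀ b : ℕ, 0 < b → b < T → ∀ V g, F (update V (![i, j + b], 0) g) = F V) :
    ∫ V, F V * ∏ b ∈ range T, ∏ a ∈ range L,
        (U ℝ (m ![i + a, j + b])).eval (su2a0 (plaquetteHolonomy V ![i + a, j + b] 0 1))
        ∂(Measure.pi fun _ : Edge 2 L => haarProbability (Matrix.specialUnitaryGroup (Fin 2) ℂ)) =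
      if (∀ a < L, ∀ b < T, m ![i + a, j + b] = m ![i, j]) then
        ((((m ![i, j] : ℝ) + 1) ^ (L * T)))⁻¹ *
          ∫ V, F V * ((U ℝ (m ![i, j])).eval (su2a0 (((List.range L).map fun a : ℕ => V (![i + a, j], 0)).prod)) *
            (U ℝ (m ![i, j])).eval (su2a0 (((List.range L).map fun a : ℕ => V (![i + a, j + T], 0)).prod)))
          ∂(Measure.pi fun _ : Edge 2 L => haarProbability (Matrix.specialUnitaryGroup (Fin 2) ℂ))
      else 0 := by
  have hL : 1 ≤ L := Nat.one_le_iff_ne_zero.mpr (NeZero.ne L)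
  rw [integral_mul_prod_rect_su2Character i j m hL le_rfl T hT hTL F hFc
    (fun a b _ haL hb V g => hFv a b haL hb V g) hFh]
  by_cases hC : ∀ a < L, ∀ b < T, m ![i + a, j + b] = m ![i, j]
  swap
  · rw [if_neg hC, if_neg hC]
  rw [if_pos hC, if_pos hC]
  obtain ⟨T₀, rfl⟩ : ∃ T₀, T = T₀ + 1 := ⟨T - 1, by omega⟩
  -- the words
  set P : GaugeConfig 2 L (Matrix.specialUnitaryGroup (Fin 2) ℂ) → Matrix.specialUnitaryGroup (Fin 2) ℂ :=
    fun V => ((List.range L).map fun a : ℕ => V (![i + a, j], 0)).prod with hP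
  set Ptop : GaugeConfig 2 L (Matrix.specialUnitaryGroup (Fin 2) ℂ) → Matrix.specialUnitaryGroup (Fin 2) ℂ :=
    fun V => ((List.range L).map fun a : ℕ => V (![i + a, j + (T₀ + 1 : ℕ)], 0)).prod with hPtop
  set S' : GaugeConfig 2 L (Matrix.specialUnitaryGroup (Fin 2) ℂ) → Matrix.specialUnitaryGroup (Fin 2) ℂ :=
    fun V => ((List.range T₀).map fun b : ℕ => V (![i, j + (b + 1 : ℕ)], 1)).prod with hS'
  set c : Edge 2 L := (![i, j], 1) with hc
  have hS : ∀ V : GaugeConfig 2 L (Matrix.specialUnitaryGroup (Fin 2) ℂ),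
      ((List.range (T₀ + 1)).map fun b : ℕ => V (![i, j + b], 1)).prod = V c * S' V := by
    intro V
    rw [list_prod_range_succ_eq_head_mul]
    simp only [Nat.cast_zero, add_zero, hS', hc]
  have hSr : ∀ V : GaugeConfig 2 L (Matrix.specialUnitaryGroup (Fin 2) ℂ),
      ((List.range (T₀ + 1)).map fun b : ℕ => V (![i + (L : ℕ), j + b], 1)).prod = V c * S' V := by
    intro V
    rw [ZMod.natCast_self, add_zero]
    exact hS V
  -- the handle
  have hPc : Continuous P := continuous_list_prod _ fun k _ => continuous_apply _
  have hPtopc : Continuous Ptop := continuous_list_prod _ fun k _ => continuous_apply _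
  have hS'c : Continuous S' := continuous_list_prod _ fun k _ => continuous_apply _
  have hPu : ∀ V g, P (update V c g) = P V := fun V g => rowProd_update_of_ne i j V c g (Or.inl rfl) L
  have hβu : ∀ V g, S' (update V c g) * (Ptop (update V c g))⁻¹ * (S' (update V c g))⁻¹ =
      S' V * (Ptop V)⁻¹ * (S' V)⁻¹ := by
    intro V g
    have h1 : S' (update V c g) = S' V := by
      refine list_prod_map_update_of_ne V c g _ _ fun k hk h => ?_
      rw [List.mem_range] at hk
      rw [hc, Prod.mk.injEq, vec2_eq_iff] at h
      exact absurd (Nat.le_of_dvd (Nat.succ_pos k) ((ZMod.natCast_eq_zero_iff (k + 1) L).1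
        (add_eq_left.mp h.1.2))) (by omega)
    have h2 : Ptop (update V c g) = Ptop V := rowProd_update_of_ne i _ V c g (Or.inl rfl) L
    rw [h1, h2]
  have hhandle := integral_pi_su2_handle (ι := Edge 2 L) c P (fun V => S' V * (Ptop V)⁻¹ * (S' V)⁻¹) F
    hPu hβu (fun V g => by simpa using hFv 0 0 hL (Nat.succ_pos _) V g) hPc (by fun_prop) hFc (m ![i, j])
  have hpt : ∀ V : GaugeConfig 2 L (Matrix.specialUnitaryGroup (Fin 2) ℂ),
      F V * (U ℝ (m ![i, j])).eval (su2a0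
        (((List.range L).map fun a : ℕ => V (![i + a, j], 0)).prod *
          ((List.range (T₀ + 1)).map fun b : ℕ => V (![i + (L : ℕ), j + b], 1)).prod *
          (((List.range L).map fun a : ℕ => V (![i + a, j + (T₀ + 1 : ℕ)], 0)).prod)⁻¹ *
          (((List.range (T₀ + 1)).map fun b : ℕ => V (![i, j + b], 1)).prod)⁻¹)) =
      (U ℝ (m ![i, j])).eval (su2a0 (P V * V c * (S' V * (Ptop V)⁻¹ * (S' V)⁻¹) * (V c)⁻¹)) * F V := by
    intro V
    rw [hSr V, hS V, mul_comm (F V)]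
    congr 2
    refine congrArg su2a0 ?_
    simp only [hP, hPtop]
    group
  simp_rw [hpt]
  rw [hhandle, ← mul_assoc, ← mul_inv, ← pow_succ,
    show L * (T₀ + 1) - 1 + 1 = L * (T₀ + 1) from Nat.sub_add_cancel (Nat.mul_pos hL (Nat.succ_pos _))]
  congr 1
  refine integral_congr_ae (Filter.Eventually.of_forall fun V => ?_)
  beta_reduce
  rw [su2a0_conj, su2a0_inv, mul_comm]

end Summit.Ventures.LatticeQCDFlow.Scoring
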